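import Summits.NavierStokesRegularity.FluidComputer.LerayFrontClock
import Summits.NavierStokesRegularity.FluidComputer.LeraySupClock
import HarnessLib

/-!
# Fluid computer — the TIME FACE of the level dictionary, VIII: the blow-up lives above every fixed level (L26)

HONEST FRAMING (cell `pub-fluidc`, verbatim): *low prior, high value-of-information experiment on Tao's
machine paradigm; NOT a claim that NS blows up.* Theorem side of the cell; nothing here is evidence of blow-up.
The front clocks (`LerayFrontClock.front_clock`, `LeraySupClock.supFront_clock`) read as DIVERGENCE statements at
a FIXED cut: the levels below any fixed `q` can hold only a bounded amount (the energy class), so what diverges at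
the lifespan must sit above `q`. For every maximal smooth solution `(u, p)` of the unforced Navier–Stokes system
on `ℝ³ × [0, T)` (`ν > 0`) which is Leray–Hopf from `u 0`:

* `tail_dyadicF_eventually_gt` / `tail_dyadicF_tendsto_top` (**L26, enstrophy currency**) — for EVERY level `q`
  the dyadic enstrophy above `q`, `Tail_q(t) = ∑_{n≥0} 4^{q+n} ‖Δ̇_{q+n} u(t)‖₂²`, tends to `+∞` as `t ↑ T`
  (indeed exceeds any `M` on a whole left neighbourhood of `T`);
* `tail_blockSup_eventually_gt` / `tail_blockSup_tendsto_top` (**L26′, amplitude currency**) — for EVERY level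
  `J` the summed block sups above `J`, `∑_{n≥0} ‖Δ̇_{J+n} u(t)‖_∞`, tend to `+∞` as `t ↑ T`.

In the machine's words: no fixed finite set of levels carries the end-game — whatever the design, the cascade's
enstrophy AND its amplitude must eventually live above any prescribed level, on a whole terminal window (not only
at a sequence of times, cf. the relay L10/L11 and the front L7). Quantitatively the divergence is at least at the
clock rates (`√(cν³/(T − t))/(6C_b²) − 8·4^q‖u(0)‖₂²`, resp. `c√ν/√(T − t) − C_∞G‖u(0)‖₂2^{3(J−1)/2}`); constants
inexplicit — words, not numbers at the cell's levels. Necessity only. 0 sorry; no new definitions, no named facts.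

## References

* J. Leray, Acta Math. 63 (1934) 193–248, §19–§20. [Leray1934]
* J. C. Robinson, J. L. Rodrigo, W. Sadowski, *The Three-Dimensional Navier–Stokes Equations*, CUP 2016,
  Lemma 6.11. [RobinsonRodrigoSadowski2016]
* H. Bahouri, J.-Y. Chemin, R. Danchin, *Fourier Analysis and Nonlinear PDE*, Springer 2011, Lemma 2.1,
  Prop. 2.12. [BahouriCheminDanchin2011]
-/

noncomputable section

open MeasureTheory Set Function Filter Topology Metric
open scoped ENNReal NNReal RealInnerProductSpace
open Literature.Analysis.FluidPDE Literature.Analysis.FunctionSpaces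

namespace Summit.NavierStokesRegularity.FluidComputer.LerayTailDivergence

/-- **Bookkeeping: a clock inequality forces divergence.** If `0 < A` and `A ≤ (K (H + X t))² · ofReal (T − t)`
for all `t ∈ (t₀, T)` with `K, H` finite, then for every finite `M` the quantity `X t` exceeds `M` on a whole left
neighbourhood of `T`. [folklore] -/
theorem eventually_gt_of_clock {T t₀ : ℝ} (hT : t₀ < T) {A K H : ℝ≥0∞} (hA : 0 < A) (hK : K ≠ ⊤) (hH : H ≠ ⊤)
    {X : ℝ → ℝ≥0∞} (hclock : ∀ t ∈ Ioo t₀ T, A ≤ (K * (H + X t)) ^ 2 * ENNReal.ofReal (T - t)) (M : ℝ≥0) :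
    ∃ t₁ < T, ∀ t ∈ Ioo t₁ T, (M : ℝ≥0∞) < X t := by
  -- the bound `B = (K (H + M))²` is finite; choose `t₁` with `B (T - t₁) < A`
  set B : ℝ≥0∞ := (K * (H + M)) ^ 2 with hB
  have hBtop : B ≠ ⊤ := ENNReal.pow_ne_top (ENNReal.mul_ne_top hK (ENNReal.add_ne_top.2 ⟨hH, ENNReal.coe_ne_top⟩))
  -- `δ` with `B · ofReal δ < A`
  obtain ⟨δ, hδ, hδA⟩ : ∃ δ : ℝ, 0 < δ ∧ B * ENNReal.ofReal δ < A := by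
    obtain ⟨n, hn, hnA⟩ := ENNReal.exists_nnreal_pos_mul_lt hBtop hA.ne'
    refine ⟨n, by exact_mod_cast hn, ?_⟩
    rwa [ENNReal.ofReal_coe_nnreal, mul_comm]
  refine ⟨max t₀ (T - δ), max_lt hT (by linarith), fun t ht => ?_⟩
  have ht₀ : t₀ < t := (le_max_left _ _).trans_lt ht.1
  have htδ : T - t < δ := by
    have := (le_max_right t₀ (T - δ)).trans_lt ht.1
    linarith
  by_contra hle
  rw [not_lt] at hle
  have h1 := hclock t ⟨ht₀, ht.2⟩
  have h2 : (K * (H + X t)) ^ 2 * ENNReal.ofReal (T - t) ≤ B * ENNReal.ofReal δ := by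
    rw [hB]
    gcongr
  exact absurd (h1.trans h2) (not_le.2 hδA)

/-- **L26 — THE DYADIC ENSTROPHY ABOVE ANY FIXED LEVEL DIVERGES AT THE LIFESPAN.** Along every maximal smooth
Leray–Hopf solution of the unforced system (`ν > 0`), for every level `q` and every `M`, there is `t₁ < T` with
`∑_{n≥0} 4^{q+n} ‖Δ̇_{q+n} u(t)‖₂² > M` for ALL `t ∈ (t₁, T)` (the front clock `LerayFrontClock.front_clock`:
the levels below `q` hold at most `8·4^q‖u(0)‖₂²`, while the clock's left side is a positive constant).
[cite: RobinsonRodrigoSadowski2016, Lemma 6.11] [cite: BahouriCheminDanchin2011, Lemma 2.1 and Prop. 2.12] -/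
theorem tail_dyadicF_eventually_gt {ν T : ℝ} (hν : 0 < ν) (hT : 0 < T)
    {u : ℝ → EuclideanSpace ℝ (Fin 3) → EuclideanSpace ℝ (Fin 3)} {p : ℝ → EuclideanSpace ℝ (Fin 3) → ℝ}
    (hmax : IsMaximalSmoothSolution ν 0 u p T) (hLH : IsLerayHopfOn T ν 0 (u 0) u) (q : ℕ) (M : ℝ≥0) :
    ∃ t₁ < T, ∀ t ∈ Ioo t₁ T,
      (M : ℝ≥0∞) < ∑' n : ℕ, (2 : ℝ≥0∞) ^ (2 * (q + n)) * blockL2 (u t) ((q + n : ℕ) : ℤ) ^ 2 := by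
  obtain ⟨c, hc, H⟩ := LerayFrontClock.front_clock
  have hE : eLpNorm (u 0) 2 volume ≠ ⊤ := (hLH.memLp 0 ⟨le_rfl, hT.le⟩).eLpNorm_ne_top
  refine eventually_gt_of_clock (t₀ := 0) hT (A := ENNReal.ofReal (c * ν ^ 3))
    (K := 6 * ((lpBounds (Fin 3)).Cb : ℝ≥0∞) ^ 2) (H := 8 * (2 : ℝ≥0∞) ^ (2 * q) * eLpNorm (u 0) 2 volume ^ 2)
    (ENNReal.ofReal_pos.2 (by positivity))
    (ENNReal.mul_ne_top (by norm_num) (ENNReal.pow_ne_top ENNReal.coe_ne_top))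
    (ENNReal.mul_ne_top (ENNReal.mul_ne_top (by norm_num) (ENNReal.pow_ne_top (by norm_num)))
      (ENNReal.pow_ne_top hE))
    (fun t ht => H ν T hν hT u p hmax hLH t ht q) M

/-- Filter form of L26: for every level `q`, `Tail_q(t) → ∞` as `t ↑ T`. [cite: RobinsonRodrigoSadowski2016, Lemma 6.11] -/
theorem tail_dyadicF_tendsto_top {ν T : ℝ} (hν : 0 < ν) (hT : 0 < T)
    {u : ℝ → EuclideanSpace ℝ (Fin 3) → EuclideanSpace ℝ (Fin 3)} {p : ℝ → EuclideanSpace ℝ (Fin 3) → ℝ}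
    (hmax : IsMaximalSmoothSolution ν 0 u p T) (hLH : IsLerayHopfOn T ν 0 (u 0) u) (q : ℕ) :
    Tendsto (fun t => ∑' n : ℕ, (2 : ℝ≥0∞) ^ (2 * (q + n)) * blockL2 (u t) ((q + n : ℕ) : ℤ) ^ 2)
      (𝓝[<] T) (𝓝 ⊤) := by
  refine ENNReal.tendsto_nhds_top_iff_nnreal.2 fun M => ?_
  obtain ⟨t₁, ht₁, h⟩ := tail_dyadicF_eventually_gt hν hT hmax hLH q M
  filter_upwards [Ioo_mem_nhdsLT ht₁] with t ht using h t ht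

/-- **L26′ — THE BLOCK SUPS ABOVE ANY FIXED LEVEL DIVERGE AT THE LIFESPAN (summed).** Along every maximal smooth
Leray–Hopf solution of the unforced system (`ν > 0`), for every level `J ∈ ℤ` and every `M`, there is `t₁ < T`
with `∑_{n≥0} ‖Δ̇_{J+n} u(t)‖_∞ > M` for ALL `t ∈ (t₁, T)` (the amplitude-front clock
`LeraySupClock.supFront_clock`: the levels below `J` hold at most `C_∞ G ‖u(0)‖₂ 2^{3(J−1)/2}`).
[cite: Leray1934, §19 (3.8)–(3.9) p. 224] [cite: BahouriCheminDanchin2011, Lemma 2.1 and Prop. 2.12] -/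
theorem tail_blockSup_eventually_gt {ν T : ℝ} (hν : 0 < ν) (hT : 0 < T)
    {u : ℝ → EuclideanSpace ℝ (Fin 3) → EuclideanSpace ℝ (Fin 3)} {p : ℝ → EuclideanSpace ℝ (Fin 3) → ℝ}
    (hmax : IsMaximalSmoothSolution ν 0 u p T) (hLH : IsLerayHopfOn T ν 0 (u 0) u) (J : ℤ) (M : ℝ≥0) :
    ∃ t₁ < T, ∀ t ∈ Ioo t₁ T, (M : ℝ≥0∞) < ∑' n : ℕ, blockSup (u t) (J + n) := by
  obtain ⟨c, hc, H⟩ := LeraySupClock.supFront_clock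
  have hE : eLpNorm (u 0) 2 volume ≠ ⊤ := (hLH.memLp 0 ⟨le_rfl, hT.le⟩).eLpNorm_ne_top
  set Hd : ℝ≥0∞ := ((lpBounds (Fin 3)).Cinf : ℝ≥0∞) * eLpNorm (u 0) 2 volume *
    (2 : ℝ≥0∞) ^ (((J - 1 : ℤ) : ℝ) * Fintype.card (Fin 3) * 2⁻¹) * LPBounds.geomDim (Fin 3) with hHd
  have hP : (2 : ℝ≥0∞) ^ (((J - 1 : ℤ) : ℝ) * Fintype.card (Fin 3) * 2⁻¹) ≠ ⊤ := by
    simp [ENNReal.rpow_eq_top_iff]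
  have hHdtop : Hd ≠ ⊤ :=
    ENNReal.mul_ne_top (ENNReal.mul_ne_top (ENNReal.mul_ne_top ENNReal.coe_ne_top hE) hP)
      LPBounds.geomDim_lt_top.ne
  -- the sup-front clock squared: `ofReal(c√ν)² ≤ (1 · (Hd + tail))² · ofReal (T - t)`
  have hclock : ∀ t ∈ Ioo 0 T, ENNReal.ofReal (c * Real.sqrt ν) ^ 2 ≤
      (1 * (Hd + ∑' n : ℕ, blockSup (u t) (J + n))) ^ 2 * ENNReal.ofReal (T - t) := by
    intro t ht
    have hTt : 0 < T - t := sub_pos.2 ht.2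
    have h := H ν T hν hT u p hmax hLH t ht J
    rw [one_mul]
    -- `ofReal (c√ν/√(T−t)) · ofReal √(T−t) = ofReal (c√ν)`
    have hsq : 0 < Real.sqrt (T - t) := Real.sqrt_pos.2 hTt
    have e1 : ENNReal.ofReal (c * Real.sqrt ν) =
        ENNReal.ofReal (c * Real.sqrt ν / Real.sqrt (T - t)) * ENNReal.ofReal (Real.sqrt (T - t)) := by
      rw [← ENNReal.ofReal_mul (by positivity), div_mul_cancel₀ _ hsq.ne']
    have e2 : ENNReal.ofReal (Real.sqrt (T - t)) ^ 2 = ENNReal.ofReal (T - t) := by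
      rw [← ENNReal.ofReal_pow (Real.sqrt_nonneg _), Real.sq_sqrt hTt.le]
    rw [e1, mul_pow, e2]
    gcongr
  obtain ⟨t₁, ht₁, h⟩ := eventually_gt_of_clock (t₀ := 0) hT (A := ENNReal.ofReal (c * Real.sqrt ν) ^ 2)
    (K := 1) (H := Hd) (ENNReal.pow_pos (ENNReal.ofReal_pos.2 (by positivity)) 2) ENNReal.one_ne_top hHdtop
    hclock M
  exact ⟨t₁, ht₁, h⟩

/-- Filter form of L26′: for every level `J`, `∑_{n≥0} ‖Δ̇_{J+n} u(t)‖_∞ → ∞` as `t ↑ T`.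
[cite: Leray1934, §19 (3.8)–(3.9) p. 224] -/
theorem tail_blockSup_tendsto_top {ν T : ℝ} (hν : 0 < ν) (hT : 0 < T)
    {u : ℝ → EuclideanSpace ℝ (Fin 3) → EuclideanSpace ℝ (Fin 3)} {p : ℝ → EuclideanSpace ℝ (Fin 3) → ℝ}
    (hmax : IsMaximalSmoothSolution ν 0 u p T) (hLH : IsLerayHopfOn T ν 0 (u 0) u) (J : ℤ) :
    Tendsto (fun t => ∑' n : ℕ, blockSup (u t) (J + n)) (𝓝[<] T) (𝓝 ⊤) := by
  refine ENNReal.tendsto_nhds_top_iff_nnreal.2 fun M => ?_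
  obtain ⟨t₁, ht₁, h⟩ := tail_blockSup_eventually_gt hν hT hmax hLH J M
  filter_upwards [Ioo_mem_nhdsLT ht₁] with t ht using h t ht

end Summit.NavierStokesRegularity.FluidComputer.LerayTailDivergence

end
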